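import Mathlib
import Literature.NumberTheory.EllipticCurves.HeegnerPointsKolyvaginPrimaryEulerProofs
import Literature.NumberTheory.EllipticCurves.HeegnerPointsOfConductor
import Literature.NumberTheory.EllipticCurves.BSDSha
import Literature.GroupTheory.FiniteAbelian.SymplecticModules

/-!
# STUB-IDEAS k1 (gen 47) — typed sketch for `stub_heegnerIndexLowerAtTwo`
# «torsion-tolerant Kolyvagin first layer at a CM-supersingular prime» (LOWER direction, weight 2)

Crux `PrintCf2.SplitBadTwoLowerHalfOfFacts` (stmt-BirchSwinnertonDyer-27851), stub
`HeegnerIndexTwo.stub_heegnerIndexLowerAtTwo`.  Nothing here proves BSD, the crux or the stub.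
This file only KERNEL-CHECKS the pure-algebra levers of the idea card and TYPES the two
statement shapes S1 (strongest provable form) / S2 (weakest sufficient residual):

* §A1 `two_pow_smul_eq_zero_of_antiEigen_mod` — the EIGEN-DEFECT LEMMA replacing Gross's use of
  Lemma 4.3 (`E(K_n)[p] = 0`) in Prop. 5.4: if `τc ≡ −c`, `τp ≡ p` and `2^k c ≡ a·p` modulo a
  `τ`-stable subgroup `D₀` killed by `2^t` (here `D₀ = δ(E(K)_tors)`), then `2^(k+t+1) c = 0`.
* §A2 `sub_one_smul_deriv_eq_of_trace_zero` — at a Kolyvagin prime with `a_ℓ = 0` (CM, ℓ inert in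
  the CM field) Kolyvagin's identity gives `(σ−1)·D_ℓ y = (ℓ+1)·y` EXACTLY (no torsion ambiguity),
  whence the canonical `2^M`-th root `((ℓ+1)/2^M)·y` (`canonical_root`): the torsion-tolerant cocycle.
* §A3 `addOrderOf_sq_dvd_card_of_addEquiv_prod_self` — weight 2: in `T ≃ L × L` (Cassels–Tate,
  tree `Literature.GroupTheory.FiniteAbelian.exists_addEquiv_prod_self`) one element of order `n`
  certifies `n² ∣ #T`.
* §A4 `sq_dvd_card_of_pairing_value` — PLAN 3's defect-free PAIR certificate: one alternating
  pairing value `B x y` of additive order `n` certifies `n² ∣ #T` (no eigen bookkeeping at all).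
* §A5 `stub_shape_of_firstLayer_of_budget` — the ℤ-shadow of the glue S1 ∧ S2 → stub inequality.
* §B  typed Props `TorsionTolerantFirstLayerAtTwo` (S1) and `FirstLayerBudgetAtTwo` (S2).
-/

namespace Summit.BirchSwinnertonDyer.BirchSwinnertonDyer.Cruxes.SplitBadTwoLowerHalfOfFacts.KolyvaginFirstLayerK1G47

/-! ## §A1 The eigen-defect lemma (replaces Gross Lemma 4.3 inside Prop. 5.4 at `p = 2`) -/

theorem two_pow_smul_eq_zero_of_antiEigen_mod {V : Type*} [AddCommGroup V] (τ : V →+ V)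
    (D₀ : AddSubgroup V) (t k : ℕ) (hD : ∀ x ∈ D₀, (2 : ℤ) ^ t • x = 0)
    (hDτ : ∀ x ∈ D₀, τ x ∈ D₀) {c p : V} (hc : τ c + c ∈ D₀) (hp : τ p - p ∈ D₀) {a : ℤ}
    (h : (2 : ℤ) ^ k • c - a • p ∈ D₀) : (2 : ℤ) ^ (k + t + 1) • c = 0 := by
  have hτd : τ ((2 : ℤ) ^ k • c - a • p) ∈ D₀ := hDτ _ h
  have hτd' : τ ((2 : ℤ) ^ k • c - a • p) = (2 : ℤ) ^ k • τ c - a • τ p := by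
    rw [map_sub, map_zsmul, map_zsmul]
  have key : (2 : ℤ) ^ (k + 1) • c =
      (2 : ℤ) ^ k • (τ c + c) + ((2 : ℤ) ^ k • c - a • p) - a • (τ p - p)
        - ((2 : ℤ) ^ k • τ c - a • τ p) := by
    module
  have hmem : (2 : ℤ) ^ (k + 1) • c ∈ D₀ := by
    rw [key]
    refine D₀.sub_mem (D₀.sub_mem (D₀.add_mem (D₀.zsmul_mem hc _) h) (D₀.zsmul_mem hp _)) ?_
    rw [← hτd']
    exact hτd
  have h0 := hD _ hmem
  rw [← mul_smul] at h0
  rw [show (2 : ℤ) ^ (k + t + 1) = 2 ^ t * 2 ^ (k + 1) by ring]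
  exact h0

/-! ## §A2 Kolyvagin's identity at a trace-zero (supersingular) prime: exact divisibility -/

open Literature.NumberTheory.EllipticCurves.KolyvaginEuler in
/-- `(σ − 1)·(D_ℓ y) = (ℓ+1)·y` when `Tr_ℓ y = 0` (which is `a_ℓ · y_{n/ℓ}` with `a_ℓ = 0`). -/
theorem sub_one_smul_deriv_eq_of_trace_zero {𝒢 : Type*} [CommGroup 𝒢] {A : Type*}
    [AddCommGroup A] [DistribMulAction 𝒢 A] {σ : 𝒢} {ℓ : ℕ} (hσ : σ ^ (ℓ + 1) = 1) {y : A}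
    (hTr : grAct A (traceElt σ ℓ) y = 0) :
    σ • grAct A (derivElt σ ℓ) y - grAct A (derivElt σ ℓ) y = (ℓ + 1) • y := by
  have h := congrArg (fun r : MonoidAlgebra ℤ 𝒢 => grAct A r y) (of_sub_one_mul_derivElt hσ)
  rw [grAct_mul, grAct_sub, grAct_of, grAct_one, grAct_sub, hTr, sub_zero] at h
  rw [h]
  exact_mod_cast grAct_natCast (ℓ + 1) y

/-- The canonical `2^M`-th root: if `2^M ∣ ℓ + 1` then `R := ((ℓ+1)/2^M)·z` satisfies
`2^M · R = (ℓ+1)·z` — applied to `z = Z_σ y_ℓ` this is the torsion-free-ness-free cocycle value. -/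
theorem canonical_root {A : Type*} [AddCommGroup A] {M ℓ : ℕ} (hM : 2 ^ M ∣ ℓ + 1) (z : A) :
    2 ^ M • (((ℓ + 1) / 2 ^ M) • z) = (ℓ + 1) • z := by
  rw [← mul_nsmul', Nat.mul_div_cancel' hM]

/-- Depth makes the root land in `2^s · A` (used twice: component-freeness at bad `v ∤ ℓ` via
GZ III.3.1 "`y_n ∈ E⁰` up to rational torsion", and `λ`-local triviality): if `2^(M+s) ∣ ℓ+1`
then `((ℓ+1)/2^M)·z ∈ 2^s · A`. -/
theorem canonical_root_mem_pow_smul {A : Type*} [AddCommGroup A] {M s ℓ : ℕ}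
    (hM : 2 ^ (M + s) ∣ ℓ + 1) (z : A) :
    ∃ w : A, ((ℓ + 1) / 2 ^ M) • z = 2 ^ s • w := by
  obtain ⟨q, hq⟩ := hM
  refine ⟨q • z, ?_⟩
  rw [← mul_nsmul', hq, pow_add, Nat.mul_assoc, Nat.mul_div_cancel_left _ (by positivity)]

/-- … and hence is killed by the torsion correction: if moreover `2^s • τ₀ = 0` then the torsion
translate contributes nothing (`((ℓ+1)/2^M)·τ₀ = 0`). -/
theorem canonical_root_torsion_vanishes {A : Type*} [AddCommGroup A] {M s ℓ : ℕ}
    (hM : 2 ^ (M + s) ∣ ℓ + 1) {τ₀ : A} (hτ : 2 ^ s • τ₀ = 0) :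
    ((ℓ + 1) / 2 ^ M) • τ₀ = 0 := by
  obtain ⟨q, hq⟩ := hM
  rw [hq, pow_add, Nat.mul_assoc, Nat.mul_div_cancel_left _ (by positivity), mul_comm, mul_nsmul',
    hτ, nsmul_zero]

/-! ## §A3 Weight 2 from the symplectic structure (Cassels–Tate) -/

theorem addOrderOf_dvd_card_of_prod_self {L : Type*} [AddCommGroup L] [Finite L] (x : L × L) :
    addOrderOf x ∣ Nat.card L := by
  rw [Prod.addOrderOf]
  exact Nat.lcm_dvd (addOrderOf_dvd_natCard x.1) (addOrderOf_dvd_natCard x.2)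

/-- One element of order `n` in `T ≃ L × L` certifies `n² ∣ #T`. -/
theorem addOrderOf_sq_dvd_card_of_addEquiv_prod_self {T L : Type*} [AddCommGroup T]
    [AddCommGroup L] [Finite L] (e : T ≃+ L × L) (x : T) : addOrderOf x ^ 2 ∣ Nat.card T := by
  have h1 : addOrderOf (e x) ∣ Nat.card L := addOrderOf_dvd_card_of_prod_self (e x)
  rw [AddEquiv.addOrderOf_eq] at h1
  rw [Nat.card_congr e.toEquiv, Nat.card_prod, ← pow_two]
  exact pow_dvd_pow_of_dvd h1 2

/-- The `2`-adic reading: `2^a ∣ ord x` in `T ≃ L × L` gives `2a ≤ v₂ #T`. -/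
theorem two_mul_le_padicValNat_card {T L : Type*} [AddCommGroup T] [AddCommGroup L] [Finite L]
    (e : T ≃+ L × L) (x : T) {a : ℕ} (ha : 2 ^ a ∣ addOrderOf x) :
    2 * a ≤ padicValNat 2 (Nat.card T) := by
  have hT : Finite T := Finite.of_equiv _ e.toEquiv.symm
  have hpos : Nat.card T ≠ 0 := Nat.card_pos.ne'
  have h : 2 ^ (2 * a) ∣ Nat.card T := by
    rw [pow_mul, ← Nat.pow_right_comm] 
    exact (pow_dvd_pow_of_dvd ha 2).trans (addOrderOf_sq_dvd_card_of_addEquiv_prod_self e x)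
  exact (padicValNat_dvd_iff_le hpos).mp h

/-! ## §A4 PLAN 3 — the defect-free PAIR certificate: one pairing value of order `n` ⇒ `n² ∣ #T` -/

/-- If `B : T →+ T →+ C` satisfies `B y y = 0` and `B x y` has additive order divisible by `n`,
then `n² ∣ #T`.  (Proof: `#T = #im(B·y) · #ker(B·y)`, `n ∣ #im(B·y)` via `B x y`; `y ∈ ker(B·y)`
and `n ∣ #im(B x ·|_{ker})` via `B x y` again.)  Here `T = Ш(W/K)[2^∞]`, `B` = Cassels–Tate,
`x = d(ℓ)`, `y = d(ℓ')`: NO eigen / torsion / transgression bookkeeping enters. -/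
theorem sq_dvd_card_of_pairing_value {T C : Type*} [AddCommGroup T] [Finite T] [AddCommGroup C]
    (B : T →+ T →+ C) {x y : T} (hyy : B y y = 0) {n : ℕ} (hn : n ∣ addOrderOf (B x y)) :
    n ^ 2 ∣ Nat.card T := by
  classical
  -- first projection: φ = B(·, y) = B.flip y
  set φ : T →+ C := B.flip y with hφ
  have hφx : φ x = B x y := by simp [hφ]
  -- #T = #range φ * #ker φ
  have hcardT : Nat.card T = Nat.card φ.range * Nat.card φ.ker := by
    rw [← Nat.card_congr (QuotientAddGroup.quotientKerEquivRange φ).toEquiv]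
    exact φ.ker.card_eq_card_quotient_mul_card_addSubgroup
  -- n ∣ #range φ
  have h1 : n ∣ Nat.card φ.range := by
    have : addOrderOf (⟨φ x, ⟨x, rfl⟩⟩ : φ.range) = addOrderOf (B x y) := by
      rw [← hφx]; exact (addOrderOf_injective φ.range.subtype Subtype.val_injective _).symm
    exact hn.trans (this ▸ addOrderOf_dvd_natCard _)
  -- second projection on ker φ: ψ = B x restricted
  have hyker : y ∈ φ.ker := by simp [hφ, AddMonoidHom.mem_ker, hyy]
  set ψ : φ.ker →+ C := (B x).comp φ.ker.subtype with hψ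
  have hcardK : Nat.card φ.ker = Nat.card ψ.range * Nat.card ψ.ker := by
    rw [← Nat.card_congr (QuotientAddGroup.quotientKerEquivRange ψ).toEquiv]
    exact ψ.ker.card_eq_card_quotient_mul_card_addSubgroup
  have h2 : n ∣ Nat.card ψ.range := by
    have hψy : ψ ⟨y, hyker⟩ = B x y := by simp [hψ]
    have : addOrderOf (⟨ψ ⟨y, hyker⟩, ⟨⟨y, hyker⟩, rfl⟩⟩ : ψ.range) = addOrderOf (B x y) := by
      rw [← hψy]; exact (addOrderOf_injective ψ.range.subtype Subtype.val_injective _).symm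
    exact hn.trans (this ▸ addOrderOf_dvd_natCard _)
  rw [hcardT, hcardK, pow_two, ← mul_assoc]
  exact (mul_dvd_mul h1 h2).mul_right _

/-! ## §A5 The ℤ-shadow of the glue  S1 ∧ S2 → stub inequality -/

/-- S1 gives `B ≥ 2(M₀ − m) − δ` with `M₀ = v₂(index)`; S2 (the residual, per member) gives an
admissible prime with `2m + δ ≤ 2·v₂(c_φ) + v₂(Tam)`; the stub's conclusion
`2·v₂(index) − 2·v₂(c_φ) ≤ B + v₂(Tam)` follows. -/
theorem stub_shape_of_firstLayer_of_budget {B vTam vc vi m δ : ℤ}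
    (hS1 : 2 * (vi - m) - δ ≤ B) (hS2 : 2 * m + δ ≤ 2 * vc + vTam) :
    2 * vi - 2 * vc ≤ B + vTam := by
  omega

/-- The crude defect budget of S1: `δ = 2·(1 + t)` from the eigen-defect lemma (`t = v₂ #E(K)[2^∞]`,
`≤ 2` on the class) — recorded so the critic can price S2: a member closes by PLAN 1 iff some
admissible `ℓ` has `2·m(ℓ) + 2 + 2t ≤ 2·v₂(c_φ) + v₂(Tam(W/K))`. -/
theorem crude_budget {vTam vc m t : ℤ} (h : m + 1 + t ≤ vc) (hT : 0 ≤ vTam) :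
    2 * m + 2 * (1 + t) ≤ 2 * vc + vTam := by
  omega

/-! ## §B The two statement shapes, typed over tree declarations -/

open WeierstrassCurve Literature.NumberTheory.EllipticCurves
  Literature.NumberTheory.EllipticCurves.ModularForms

/-- `P` is `2^k`-divisible up to the finite torsion of `A`: `∃ Q, 2^k • Q = n_t • P`,
`n_t = #A_tors` (so `k ≤ v₂` of the index of `ℤ·P` in its saturation). -/
def DivisibleUpToTorsion {A : Type*} [AddCommGroup A] (k : ℕ) (P : A) : Prop :=
  ∃ Q : A, 2 ^ k • Q = Nat.card (AddCommGroup.torsion A) • P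

open scoped Classical in
/-- **S1 (strongest provable form; theorem-shaped, constructive, LOWER, weight 1 per class).**
For a CM curve `W/ℚ`, a Heegner field `K` (`d_K < −4`), the Heegner point `P = y_K ∈ E(K)`
(`d₁`), a level `M` with `y_K` `2^M`-divisible up to torsion, `t = v₂ #E(K)_tors`, and a Kolyvagin
prime `ℓ` for `(2, ·)` with `a_ℓ = 0` and DEPTH `2^(M+t+1) ∣ ℓ+1` (supplied with density > 0 by the
LANDED `exists_isKolyvaginPrime_two_depth` mechanism on the CM-inert class of `F = ℚ(√−7)`):
if the derived point `P_ℓ = D_ℓ y_ℓ ∈ E(K[ℓ])` is NOT `2^(m+1)`-divisible up to torsion, then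
`Ш(W/K)[2^∞]` contains an element of order divisible by `2^(M − m − 1 − t)` — namely the inflation
of the torsion-tolerant cocycle `σ ↦ −((ℓ+1)/2^M)·Z_σ y_ℓ` (§A2).  Inputs in print: Gross 3.7 (1)
(tree THEOREM `GrossLMS1991.prop37_1_traceRelation_holds` / `CoatesLiTianZhai2015.finsum_…`),
Gross 3.7 (2) (named fact `GrossLMS1991.prop37_2_reductionCongruence_inert`), GZ III.3.1. -/
def TorsionTolerantFirstLayerAtTwo : Prop :=
  ∀ (N : ℕ) [NeZero N] (W : WeierstrassCurve ℚ) [W.IsElliptic] [W.IsGloballyMinimal],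
    W.HasCM → W.conductorNorm ℤ = N →
  ∀ (K : Type) [Field K] [NumberField K], IsImaginaryQuadratic K → NumberField.discr K < -4 →
    SatisfiesHeegnerHypothesis N K →
  ∀ (Dt : ModularParametrizationData W N) (β : ℤ) (ι : K →+* ℂ)
    (d₁ : KolyvaginHeegnerData Dt β ι 1) (P : (W.baseChange K).toAffine.Point),
    d₁.toGeomPoints d₁.derivedPoint = toGeomPoints (W.baseChange K) P → ¬ IsOfFinAddOrder P →
  ∀ (M t : ℕ), DivisibleUpToTorsion M P →
    padicValNat 2 (Nat.card (AddCommGroup.torsion (W.baseChange K).toAffine.Point)) = t →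
  ∀ (ℓ : ℕ), Zhang2014.IsKolyvaginPrime N W K 2 ℓ → W.frobeniusTrace ℓ = 0 →
    2 ^ (M + t + 1) ∣ ℓ + 1 →
  ∀ (dℓ : KolyvaginHeegnerData Dt β ι ℓ) (m : ℕ), ¬ DivisibleUpToTorsion (m + 1) dℓ.derivedPoint →
    ∃ x : (W.baseChange K).sha,
      x ∈ AddCommGroup.primaryComponent ((W.baseChange K).sha) 2 ∧ 2 ^ (M - m - 1 - t) ∣ addOrderOf x

open scoped Classical in
/-- **S2 (weakest sufficient residual, per member; decidable from ONE derived point).**  Some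
admissible supersingular Kolyvagin prime of the required depth has derived point shallow enough:
`2·(m(ℓ) + 1 + t) ≤ 2·v₂(c_φ) + v₂(Tam(W/K))`.  With S1 + Cassels–Tate (§A3) this is exactly what
`stub_shape_of_firstLayer_of_budget` consumes. -/
def FirstLayerBudgetAtTwo : Prop :=
  ∀ (N : ℕ) [NeZero N] (W : WeierstrassCurve ℚ) [W.IsElliptic] [W.IsGloballyMinimal],
    W.HasCM → W.conductorNorm ℤ = N →
  ∀ (K : Type) [Field K] [NumberField K], IsImaginaryQuadratic K → NumberField.discr K < -4 →
    SatisfiesHeegnerHypothesis N K →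
  ∀ (Dt : ModularParametrizationData W N) (β : ℤ) (ι : K →+* ℂ)
    (d₁ : KolyvaginHeegnerData Dt β ι 1) (P : (W.baseChange K).toAffine.Point),
    d₁.toGeomPoints d₁.derivedPoint = toGeomPoints (W.baseChange K) P → ¬ IsOfFinAddOrder P →
    (W.baseChange K).analyticRank = 1 →
  ∀ (M t : ℕ), DivisibleUpToTorsion M P → ¬ DivisibleUpToTorsion (M + 1) P →
    padicValNat 2 (Nat.card (AddCommGroup.torsion (W.baseChange K).toAffine.Point)) = t →
  ∃ (ℓ : ℕ) (dℓ : KolyvaginHeegnerData Dt β ι ℓ) (m : ℕ),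
    Zhang2014.IsKolyvaginPrime N W K 2 ℓ ∧ W.frobeniusTrace ℓ = 0 ∧ 2 ^ (M + t + 1) ∣ ℓ + 1 ∧
    ¬ DivisibleUpToTorsion (m + 1) dℓ.derivedPoint ∧
    2 * ((m : ℤ) + 1 + t) ≤ 2 * (padicValNat 2 Dt.c.natAbs : ℤ) +
      (padicValNat 2 (W.baseChange K).tamagawaProduct : ℤ)

end Summit.BirchSwinnertonDyer.BirchSwinnertonDyer.Cruxes.SplitBadTwoLowerHalfOfFacts.KolyvaginFirstLayerK1G47
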